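import Summits.KontsevichZagierPeriods.KontsevichZagierPeriods.Theorems.AbelContractionRealHyperellipticSectorDefs
import Summits.KontsevichZagierPeriods.KontsevichZagierPeriods.Theorems.AbelContractionRealHyperellipticSectorBudgetKit
import Literature.NumberTheory.Transcendental.SemialgebraicLineDeriv
import Summits.KontsevichZagierPeriods.KontsevichZagierPeriods.Theorems.BetaCancellation.Negative.KernelForm

/-!
# Route AbelContraction — `RealHyperellipticSector` (crux stmt-KontsevichZagierPeriods-12475):
# exact arcs are one Newton–Leibniz move

Pure proof file of the line `Lines/birth.lean` (registered brick `arc_exact_sub_const`,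
`--supports` the crux). **Exact forms are one Newton–Leibniz move `1 → 0` with an algebraic
primitive, inside the budget `KZ.relationsLE 1`.** If the integrand `(A + B√q)/D` of an arc `r` of
the real hyperelliptic curve `y² = q(x)` over the open interval `(a, b)` (`a < b` real algebraic,
`q > 0` and `W ≠ 0` on `[a, b]`) is on `(a, b)` the derivative of `F = (U + V√q)/W`
(`U V W ∈ ℚ[X]`), then `[r] − [pt, F(b) − F(a)] ∈ KZ.relationsLE 1` for every point representation
`c` over `ℝ⁰` with the constant `F(b) − F(a)`.

Derivation inside the calculus (no integral is evaluated):
* the CLOSED slab `R = [[a, b], (A + B√q)/D]` (the explicit formula, `ℚ`-semialgebraic on the slab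
  by the junk-valued inverse, integrable because it is `r.integrand` off the two null endpoints);
* ONE Newton–Leibniz move over the point `ℝ⁰` (rule (3), `Budget.newtonLeibniz_mem_relationsLE`
  with `k = 0`, `d = 1`): constant edges `a ≤ b`, primitive `z ↦ F (z 0)` — `ℚ`-semialgebraic on
  the slab (`W ≠ 0` there), continuous on `[a, b]`, with the given derivative on `(a, b)` — so
  `[R] − [c] ∈ relationsLE 1`;
* rule (1a) across the two null endpoints (`Budget.of_sub_of_restrict_mem_relationsLE`) and
  congruence of integrands on `(a, b)` (`Budget.congr_mem_relationsLE`): `[R] ≡ [r]`.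

References: M. Kontsevich, D. Zagier, *Periods* (2001), §1.2 rules (1), (3) [KontsevichZagier2001];
J. Bochnak, M. Coste, M.-F. Roy, *Real Algebraic Geometry* (1998), §2.2 [BochnakCosteRoy1998].
No definitions are introduced.
-/

noncomputable section

open Set MeasureTheory
open scoped Polynomial
open Literature.ModelTheory.ExponentialFields
open Literature.NumberTheory.Transcendental Literature.NumberTheory.Transcendental.KZ
open Summit.KontsevichZagierPeriods.KontsevichZagierPeriods.BetaCancellationNegative
  (volume_setOf_apply_eq_zero)

namespace Summit.KontsevichZagierPeriods.AbelContraction.RealHyperellipticSector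

namespace ArcExact

/-- A one-variable rational polynomial evaluated at one coordinate, `z ↦ P(z i)`, is a
`ℚ`-semialgebraic function on every `ℚ`-semialgebraic `s ⊆ ℝⁿ` (it is the `MvPolynomial`
`P(Xᵢ)`). [cite: BochnakCosteRoy1998, §2.2] -/
theorem isSemialgebraicFunOn_aeval_apply {n : ℕ} {s : Set (Fin n → ℝ)}
    (hs : IsSemialgebraic ℚ s) (P : ℚ[X]) (i : Fin n) :
    IsSemialgebraicFunOn ℚ s (fun z => (Polynomial.aeval (z i) P : ℝ)) :=
  (isSemialgebraicFunOn_aeval hs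
    (Polynomial.aeval (MvPolynomial.X i : MvPolynomial (Fin n) ℚ) P)).congr fun z _ => by
      simp only
      rw [← Polynomial.aeval_algHom_apply, MvPolynomial.aeval_X]

/-- The hyperelliptic integrand `z ↦ (A(z i) + B(z i)·√(q(z i)))/D(z i)` (`A B D q ∈ ℚ[X]`,
Mathlib's junk values `√(negative) = 0`, `x/0 = 0` included) is a `ℚ`-semialgebraic function on
every `ℚ`-semialgebraic `s ⊆ ℝⁿ`. [cite: BochnakCosteRoy1998, Prop. 2.2.6] -/
theorem isSemialgebraicFunOn_hyperelliptic {n : ℕ} {s : Set (Fin n → ℝ)}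
    (hs : IsSemialgebraic ℚ s) (q A B D : ℚ[X]) (i : Fin n) :
    IsSemialgebraicFunOn ℚ s (fun z => (Polynomial.aeval (z i) A +
      Polynomial.aeval (z i) B * Real.sqrt (Polynomial.aeval (z i) q)) /
        (Polynomial.aeval (z i) D : ℝ)) :=
  (((isSemialgebraicFunOn_aeval_apply hs A i).fun_add
    ((isSemialgebraicFunOn_aeval_apply hs B i).fun_mul
      (isSemialgebraicFunOn_aeval_apply hs q i).fun_sqrt)).fun_mul
    (isSemialgebraicFunOn_aeval_apply hs D i).fun_inv).congr fun _ _ => (div_eq_mul_inv _ _).symm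

/-- The closed coordinate slab `{z | a ≤ z i ≤ b} ⊆ ℝⁿ` with real algebraic ends is
`ℚ`-semialgebraic (complements of the two open half-spaces `{z i < a}`, `{b < z i}`).
[cite: KontsevichZagier2001, §1.1] -/
theorem isSemialgebraic_slab {n : ℕ} {a b : ℝ} (ha : IsAlgebraic ℚ a) (hb : IsAlgebraic ℚ b)
    (i : Fin n) : IsSemialgebraic ℚ {z : Fin n → ℝ | a ≤ z i ∧ z i ≤ b} := by
  have h : {z : Fin n → ℝ | a ≤ z i ∧ z i ≤ b} =
      {z : Fin n → ℝ | z i < a}ᶜ ∩ {z : Fin n → ℝ | b < z i}ᶜ := by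
    ext z
    simp only [mem_setOf_eq, mem_inter_iff, mem_compl_iff, not_lt]
  rw [h]
  exact (isSemialgebraic_setOf_apply_lt_const ha i).compl.inter
    (isSemialgebraic_setOf_const_lt_apply hb i).compl

/-- The two ends of a coordinate slab of the line are Lebesgue-null:
`{a ≤ z 0 ≤ b} ∖ {a < z 0 < b} ⊆ {z 0 = a} ∪ {z 0 = b}`, two null hyperplanes
(`BetaCancellationNegative.volume_setOf_apply_eq_zero`). [folklore] -/
theorem volume_slab_diff_open (a b : ℝ) :
    volume ({z : Fin 1 → ℝ | a ≤ z 0 ∧ z 0 ≤ b} \ {z | a < z 0 ∧ z 0 < b}) = 0 := by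
  refine measure_mono_null (fun z hz => ?_)
    (measure_union_null (volume_setOf_apply_eq_zero (0 : Fin 1) a)
      (volume_setOf_apply_eq_zero (0 : Fin 1) b))
  simp only [mem_sdiff, mem_setOf_eq, not_and, not_lt] at hz
  simp only [mem_union, mem_setOf_eq]
  obtain ⟨⟨h1, h2⟩, h3⟩ := hz
  rcases h1.lt_or_eq with h1 | h1
  · exact Or.inr (le_antisymm h2 (h3 h1))
  · exact Or.inl h1.symm

end ArcExact

/-- **Brick `arc_exact_sub_const`** (registered stub of crux stmt-KontsevichZagierPeriods-12475,
line `Lines/birth.lean`): **an exact arc is one Newton–Leibniz move `1 → 0` with an algebraic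
primitive, inside the budget `relationsLE 1`.** If the arc integrand `(A + B√q)/D` of `r` over
`(a, b)` (`a < b` real algebraic, `q > 0` and `W ≠ 0` on `[a, b]`) is the derivative on `(a, b)` of
`F = (U + V√q)/W`, then `[r] − [pt, F(b) − F(a)] ∈ KZ.relationsLE 1`: rule (3) over the point
`ℝ⁰` on the closed slab `[[a, b], (A + B√q)/D]` (constant algebraic edges, primitive `F`
semialgebraic on the slab, continuous on `[a, b]`), then rule (1a) across the two null endpoints
and congruence of integrands on `(a, b)`. [cite: KontsevichZagier2001, §1.2 rule (3)] -/
theorem arc_exact_sub_const : ∀ (q A B D U V W : Polynomial ℚ) (a b : ℝ) (r : KZ.IntegralRep 1)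
    (c : KZ.IntegralRep 0), IsAlgebraic ℚ a → IsAlgebraic ℚ b → a < b →
    r.domain = {p | a < p 0 ∧ p 0 < b} →
    (∀ t ∈ Set.Icc a b, 0 < Polynomial.aeval t q ∧ Polynomial.aeval t W ≠ 0) →
    Set.EqOn r.integrand (fun p => (Polynomial.aeval (p 0) A + Polynomial.aeval (p 0) B *
      Real.sqrt (Polynomial.aeval (p 0) q)) / Polynomial.aeval (p 0) D) r.domain →
    (∀ t ∈ Set.Ioo a b, HasDerivAt (fun s : ℝ => (Polynomial.aeval s U + Polynomial.aeval s V *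
      Real.sqrt (Polynomial.aeval s q)) / Polynomial.aeval s W)
      ((Polynomial.aeval t A + Polynomial.aeval t B * Real.sqrt (Polynomial.aeval t q)) /
        Polynomial.aeval t D) t) →
    c.domain = Set.univ →
    (∀ z, c.integrand z = (Polynomial.aeval b U + Polynomial.aeval b V *
        Real.sqrt (Polynomial.aeval b q)) / Polynomial.aeval b W -
      (Polynomial.aeval a U + Polynomial.aeval a V * Real.sqrt (Polynomial.aeval a q)) /
        Polynomial.aeval a W) →
    KZ.of r - KZ.of c ∈ KZ.relationsLE 1 := by
  intro q A B D U V W a b r c ha hb hab hrd hqW hri hderiv hcd hci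
  -- the integrand formula and the primitive, as functions of one real variable
  obtain ⟨f, hf⟩ : ∃ f : ℝ → ℝ, f = fun s => (Polynomial.aeval s A + Polynomial.aeval s B *
      Real.sqrt (Polynomial.aeval s q)) / Polynomial.aeval s D := ⟨_, rfl⟩
  obtain ⟨F, hF⟩ : ∃ F : ℝ → ℝ, F = fun s => (Polynomial.aeval s U + Polynomial.aeval s V *
      Real.sqrt (Polynomial.aeval s q)) / Polynomial.aeval s W := ⟨_, rfl⟩
  -- the closed slab `C = [a, b] ⊆ ℝ¹`
  obtain ⟨C, hC⟩ : ∃ C : Set (Fin 1 → ℝ), C = {z | a ≤ z 0 ∧ z 0 ≤ b} := ⟨_, rfl⟩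
  have hCsa : IsSemialgebraic ℚ C := hC ▸ ArcExact.isSemialgebraic_slab ha hb 0
  have hrC : r.domain ⊆ C := by
    rw [hrd, hC]
    exact fun z hz => ⟨hz.1.le, hz.2.le⟩
  have hnull : volume (C \ r.domain) = 0 := by
    rw [hC, hrd]
    exact ArcExact.volume_slab_diff_open a b
  -- the formula is semialgebraic on the closed slab and integrable there (it is `r.integrand` a.e.)
  have hfC : IsSemialgebraicFunOn ℚ C (fun z => f (z 0)) := by
    rw [hf]
    exact ArcExact.isSemialgebraicFunOn_hyperelliptic hCsa q A B D 0
  have hfi : IntegrableOn (fun z : Fin 1 → ℝ => f (z 0)) C := by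
    have h1 : IntegrableOn (fun z : Fin 1 → ℝ => f (z 0)) r.domain :=
      r.integrableOn.congr_fun (fun z hz => by rw [hri hz, hf])
        (IntegralRep.measurableSet_domain_holds r)
    have h2 : IntegrableOn (fun z : Fin 1 → ℝ => f (z 0)) (C \ r.domain) :=
      IntegrableOn.of_measure_zero hnull
    exact (h1.union h2).mono_set fun z hz => by
      by_cases h : z ∈ r.domain
      · exact Or.inl h
      · exact Or.inr ⟨hz, h⟩
  -- the closed-slab representation `R = [[a, b], f]`
  obtain ⟨R, hRd, hRi⟩ : ∃ R : IntegralRep 1, R.domain = C ∧ R.integrand = fun z => f (z 0) :=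
    ⟨⟨C, fun z => f (z 0), hCsa, hfC, hfi⟩, rfl, rfl⟩
  have hs0 : ∀ (x : Fin 0 → ℝ) (t : ℝ), (Fin.snoc x t : Fin 1 → ℝ) 0 = t := fun _ _ => rfl
  have hcsa : IsSemialgebraic ℚ c.domain := c.isSemialgebraic_domain
  -- (i) ONE Newton–Leibniz move `1 → 0` over `ℝ⁰`: `[R] − [c] ∈ relationsLE 1`
  have hNL : of R - of c ∈ relationsLE 1 := by
    refine Budget.newtonLeibniz_mem_relationsLE le_rfl (fun _ => a) (fun _ => b)
      (fun z => F (z 0)) ?_ (isSemialgebraicFunOn_const_of_isAlgebraic hcsa ha)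
      (isSemialgebraicFunOn_const_of_isAlgebraic hcsa hb) (fun _ _ => hab.le) ?_ ?_ ?_ ?_
    · -- the primitive is semialgebraic on the slab (`W ≠ 0` there)
      rw [hRd, hF]
      refine ((ArcExact.isSemialgebraicFunOn_aeval_apply hCsa U 0).fun_add
        ((ArcExact.isSemialgebraicFunOn_aeval_apply hCsa V 0).fun_mul
          (ArcExact.isSemialgebraicFunOn_aeval_apply hCsa q 0).fun_sqrt)).div
        (ArcExact.isSemialgebraicFunOn_aeval_apply hCsa W 0) fun z hz => ?_
      rw [hC] at hz
      exact (hqW (z 0) hz).2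
    · rw [hRd, hcd, hC]
      ext z
      simp only [mem_setOf_eq, mem_univ, true_and]
      rfl
    · -- continuity of `t ↦ F t` on the closed fibre
      intro x _
      simp only [hs0, hF]
      exact (((Polynomial.continuous_aeval U).add ((Polynomial.continuous_aeval V).mul
        (Polynomial.continuous_aeval q).sqrt)).continuousOn).div
        (Polynomial.continuous_aeval W).continuousOn fun t ht => (hqW t ht).2
    · -- derivative on the open fibre (the hypothesis)
      intro x _ t ht
      rw [hRi]
      simp only [hs0, hF, hf]
      exact hderiv t ht
    · intro x _
      rw [hci]
      simp only [hs0, hF]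
  -- (ii) closed slab versus the open slab `r.domain` (null endpoints), and congruence with `r`
  have hrR : r.domain ⊆ R.domain := hRd ▸ hrC
  have h2 : of R - of (R.restrict r.domain r.isSemialgebraic_domain hrR) ∈ relationsLE 1 :=
    Budget.of_sub_of_restrict_mem_relationsLE le_rfl R r.isSemialgebraic_domain hrR
      (by rw [hRd]; exact hnull)
  have h3 : of (R.restrict r.domain r.isSemialgebraic_domain hrR) - of r ∈ relationsLE 1 :=
    Budget.congr_mem_relationsLE le_rfl rfl fun z hz => by
      rw [IntegralRep.integrand_restrict, hRi, hri hz, hf]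
  have e : of r - of c =
      (of R - of c) - (of R - of (R.restrict r.domain r.isSemialgebraic_domain hrR)) -
        (of (R.restrict r.domain r.isSemialgebraic_domain hrR) - of r) := by abel
  rw [e]
  exact (relationsLE 1).sub_mem ((relationsLE 1).sub_mem hNL h2) h3

end Summit.KontsevichZagierPeriods.AbelContraction.RealHyperellipticSector

end
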